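import Summits.HodgeConjecture.HodgeConjecture.Theorems.Ring2WeilCoverageCMFieldRationalPrimeRule
import Summits.HodgeConjecture.HodgeConjecture.Theorems.Ring2WeilCoverageCMFieldNormResidueSymbolsDyadicCarriers
import HarnessLib

/-!
# Ring 2 — Weil-family coverage, CM-field rows: THE RATIONAL PRIME RULE, instances III: `ℚ(√-2,√5)`, `ℚ(√-2,√-5)` (in `ℚ(ζ₄₀)`), `ℚ(i,√15)` (in `ℚ(ζ₆₀)`) (§b03.29)
  (WEIL-FAMILY-COVERAGE «## b03», cell (xxi′), part 18)

research route conditional on HC_CM; not a corollary; Q11.4-sentence-2 already refuted in dim ≥ 3.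

For each biquadratic census carrier `R = S² + pS + q` below (`E = ℚ[T]/(R(T²)) = F(√b₀)`, `F = ℚ[S]/(R) = ℚ(√d)`,
`b₀ ∈ {-1, -2, -3, -5}`) [cite: Deligne1982HodgeCycles, §4 p. 30, (1), Cor. 4.2] the column «primes: `[ℓ] ≠ [1] ⟺ …`» of
the census tables (§b03.5 / §b03.29 (3), tier S: projection formula) becomes a KERNEL THEOREM for EVERY rational prime `ℓ`:
**`[ℓ] ≠ [(-1)^k]` (`k` even) `⟺ ℓ mod N ∈ {…}`** — by part 14's rule (`ℓ` odd, `ℓ ∤ disc·b₀`: `(disc|ℓ) = 1 ∧ (b₀|ℓ) = -1`),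
part 15's Legendre-symbol congruences, and explicit norms `ℓ = x² - b₀y²` at the finitely many primes `ℓ ∣ 2·disc·b₀`.
Per carrier: `√d ∈ 𝓞_F` (resp. the golden integer for `d = 5`), the uniqueness of the dyadic place of `F` (part 13:
`(2, π)² = (2)` resp. `N v₂ = 4`), the split classes of the special primes, and the rule.
* `ℚ(√-2,√5)` (`R = S² + 6S + 4`): `[ℓ] ≠ [1] ⟺ ℓ ≡ 21, 29, 31, 39 (mod 40)`.
* `ℚ(√-2,√-5)` (`R = S² + 14S + 9`): `[ℓ] ≠ [1] ⟺ ℓ ≡ 13, 31, 37, 39 (mod 40)`.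
* `ℚ(i,√15)` (`R = S² + 32S + 196`): `[ℓ] ≠ [1] ⟺ ℓ ≡ 7, 11, 43, 59 (mod 60)`.
No new definition, no named fact, no sorry; nothing about the Hodge conjecture is asserted.
-/

noncomputable section

set_option linter.dupNamespace false

open Polynomial NumberField IsDedekindDomain

namespace Summit.HodgeConjecture.HodgeConjecture.Ring2.WeilCoverageCM

open Literature.AlgebraicGeometry.Deligne1982
open Literature.AlgebraicGeometry.HodgeTheory (splitDiscriminantClassCM)
open Literature.NumberTheory.QuadraticForms

variable {R : Polynomial ℤ} [Fact (Irreducible (cmPolyQ R))] [Fact (Irreducible (realPolyQ R))]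

/-! ### §43 `E = ℚ(√-2,√5)` (`R = S² + 6S + 4`, `F = ℚ(√5)`, `E = F(√-2)`, `p² - 4q = 20 = 5·2²`):
  `[ℓ] ≠ [1] ⟺ ℓ ≡ 21, 29, 31, 39 (mod 40)` -/
section IsqrtNeg2Sqrt5
omit [Fact (Irreducible (cmPolyQ R))] in
/-- The golden integer `ω = (1 + √5)/2 = (2θ + 6 + 2)/4 ∈ 𝓞_F`: `ω² = ω + 1`. [folklore] -/
theorem sqrtNeg2Sqrt5_ratPrimeRule_exists_golden (hR : R = X ^ 2 + C 6 * X + C 4) :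
    ∃ s : 𝓞 (realField R), (s : realField R) = (2 * AdjoinRoot.root (realPolyQ R) + 6 + 2) / 4 ∧ s ^ 2 = s + 1 := by
  have hrel := root_rel_quadratic hR
  push_cast at hrel
  have hsq : ((2 * AdjoinRoot.root (realPolyQ R) + 6 + 2) / 4) ^ 2 = (2 * AdjoinRoot.root (realPolyQ R) + 6 + 2) / 4 + (1 : realField R) := by
    field_simp
    linear_combination (4 : realField R) * hrel
  have hint : IsIntegral ℤ ((2 * AdjoinRoot.root (realPolyQ R) + 6 + 2) / 4 : realField R) := by
    refine ⟨X ^ 2 - X - C 1, by monicity!, ?_⟩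
    simp [hsq]
  refine ⟨⟨_, hint⟩, rfl, ?_⟩
  refine RingOfIntegers.ext ?_
  simp only [map_pow, map_add, map_one]
  exact hsq

omit [Fact (Irreducible (cmPolyQ R))] in
/-- **`F = ℚ(√5)` has exactly one dyadic place** (in this carrier's terms). [folklore] -/
theorem sqrtNeg2Sqrt5_ratPrimeRule_dyadic_unique (hR : R = X ^ 2 + C 6 * X + C 4) (v v' : HeightOneSpectrum (𝓞 (realField R)))
    (h2 : (2 : 𝓞 (realField R)) ∈ v.asIdeal) (h2' : (2 : 𝓞 (realField R)) ∈ v'.asIdeal) : v = v' := by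
  obtain ⟨s, -, hs⟩ := sqrtNeg2Sqrt5_ratPrimeRule_exists_golden hR
  have hx : ∀ w : HeightOneSpectrum (𝓞 (realField R)), s ^ 2 - s ∉ w.asIdeal := fun w h ↦
    w.isPrime.ne_top ((Ideal.eq_top_iff_one _).2 (by rwa [show s ^ 2 - s = 1 by rw [hs]; ring] at h))
  exact dyadic_unique_of_sq_sub_self_notMem (finrank_realField_quadratic hR) v v' h2 h2' (hx v) (hx v')

/-- **`[2] = [1]`** for `ℚ(√-2,√5)`: `2 = x² - (-2)·y²` with `x = 0`, `y = 1` in `F` (a norm from `E`).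
[cite: Deligne1982HodgeCycles, §4 Cor. 4.2] -/
theorem sqrtNeg2Sqrt5_ratPrimeRule_mk_two_eq_splitDiscriminantClassCM (hR : R = X ^ 2 + C 6 * X + C 4) (qℓ : (realField R)ˣ) (hq : (qℓ : realField R) = 2)
    {k : ℕ} (hk : Even k) : (QuotientGroup.mk qℓ : cmNormResidueGroup R) = splitDiscriminantClassCM R k := by
  have hrel := root_rel_quadratic hR
  push_cast at hrel
  have hfac : AdjoinRoot.root (realPolyQ R) = ((1 : realField R) + (1/2 : realField R) * AdjoinRoot.root (realPolyQ R)) ^ 2 * (-2 : realField R) := by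
    linear_combination (1/2 : realField R) * hrel
  exact mk_eq_splitDiscriminantClassCM_of_eq_sq_sub_mul_sq hfac qℓ (x := (0 : realField R)) (y := (1 : realField R))
    (by rw [hq]; linear_combination (0 : realField R) * hrel) hk

/-- **`[5] = [1]`** for `ℚ(√-2,√5)`: `5 = x² - (-2)·y²` with `x = θ + 3`, `y = 0` in `F` (a norm from `E`).
[cite: Deligne1982HodgeCycles, §4 Cor. 4.2] -/
theorem sqrtNeg2Sqrt5_ratPrimeRule_mk_five_eq_splitDiscriminantClassCM (hR : R = X ^ 2 + C 6 * X + C 4) (qℓ : (realField R)ˣ) (hq : (qℓ : realField R) = 5)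
    {k : ℕ} (hk : Even k) : (QuotientGroup.mk qℓ : cmNormResidueGroup R) = splitDiscriminantClassCM R k := by
  have hrel := root_rel_quadratic hR
  push_cast at hrel
  have hfac : AdjoinRoot.root (realPolyQ R) = ((1 : realField R) + (1/2 : realField R) * AdjoinRoot.root (realPolyQ R)) ^ 2 * (-2 : realField R) := by
    linear_combination (1/2 : realField R) * hrel
  exact mk_eq_splitDiscriminantClassCM_of_eq_sq_sub_mul_sq hfac qℓ (x := ((3 : realField R) + (1 : realField R) * AdjoinRoot.root (realPolyQ R))) (y := (0 : realField R))
    (by rw [hq]; linear_combination (-1 : realField R) * hrel) hk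

/-- **THE RATIONAL PRIME RULE for `ℚ(√-2,√5)`**: for EVERY rational prime `ℓ`, the class `[ℓ]` of the census table
`W_{2k}.E.δ` (`k` even) is non-split iff **`ℓ ≡ 21, 29, 31, 39 (mod 40)`** — i.e. iff `ℓ` splits in `F = ℚ(√5)` into two places
inert in `E = F(√-2)` (`(20|ℓ) = 1`, `(-2|ℓ) = -1`); the primes `ℓ ∣ 2·20·2` are norms.
[cite: Deligne1982HodgeCycles, §4 (1) and Cor. 4.2] [cite: Omeara1963, §63B Example 63:12 and §71D Thm. 71:18] -/
theorem sqrtNeg2Sqrt5_mk_prime_ne_splitDiscriminantClassCM_iff_mod (hR : R = X ^ 2 + C 6 * X + C 4) {ℓ : ℕ} (hℓ : ℓ.Prime)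
    (qℓ : (realField R)ˣ) (hq : (qℓ : realField R) = ℓ) {k : ℕ} (hk : Even k) :
    (QuotientGroup.mk qℓ : cmNormResidueGroup R) ≠ splitDiscriminantClassCM R k ↔
      ℓ % 40 = 21 ∨ ℓ % 40 = 29 ∨ ℓ % 40 = 31 ∨ ℓ % 40 = 39 := by
  by_cases h2 : ℓ = 2
  · subst h2
    exact iff_of_false (not_not.2 (sqrtNeg2Sqrt5_ratPrimeRule_mk_two_eq_splitDiscriminantClassCM hR qℓ (by rw [hq]; norm_num) hk))
      (by omega)
  by_cases h5 : ℓ = 5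
  · subst h5
    exact iff_of_false (not_not.2 (sqrtNeg2Sqrt5_ratPrimeRule_mk_five_eq_splitDiscriminantClassCM hR qℓ (by rw [hq]; norm_num) hk))
      (by omega)
  haveI := Fact.mk hℓ
  obtain ⟨hRm, -⟩ := monic_and_natDegree_of_quadratic R hR
  obtain ⟨θₒ, hθ⟩ := exists_ringOfIntegers_coe_eq_root hRm
  have hroots := roots_real_neg_of_quadratic hR (by norm_num) (by norm_num) (by norm_num)
  have hrel := root_rel_quadratic hR
  push_cast at hrel
  have hdisc : ¬ (ℓ : ℤ) ∣ (6 : ℤ) ^ 2 - 4 * 4 := fun h ↦ by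
    have h' : ℓ ∣ 2 ^ 2 * 3 ^ 0 * 5 ^ 1 := by norm_num at h ⊢; exact_mod_cast h
    rcases eq_of_prime_dvd_two_pow_mul hℓ h' with rfl | rfl | rfl <;> omega
  have hm0 : (2 : ZMod ℓ) ≠ 0 := by
    have h : ¬ ℓ ∣ 2 := fun h ↦ by
      rcases eq_of_prime_dvd_two_pow_mul hℓ (a := 1) (b := 0) (c := 0) (by norm_num; exact h) with rfl | rfl | rfl <;> omega
    have := (not_congr (ZMod.natCast_eq_zero_iff 2 ℓ)).2 h
    exact_mod_cast this
  have hfac : AdjoinRoot.root (realPolyQ R) = -2 * ((1 : realField R) + (1/2 : realField R) * AdjoinRoot.root (realPolyQ R)) ^ 2 := by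
    linear_combination (1/2 : realField R) * hrel
  rw [mk_natCast_ne_splitDiscriminantClassCM_iff_of_root_eq_neg_two_mul_sq hR hroots hθ hfac (sqrtNeg2Sqrt5_ratPrimeRule_dyadic_unique hR) hℓ h2
    hdisc qℓ hq hk]
  push_cast
  rw [show (20 : ZMod ℓ) = 5 * 2 ^ 2 by norm_num, isSquare_mul_sq_iff_of_ne_zero hm0, isSquare_five_iff h2 h5, ZMod.exists_sq_eq_neg_two_iff h2]
  have hodd : ℓ % 2 = 1 := (Nat.Prime.mod_two_eq_one_iff_ne_two hℓ).2 h2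
  have h5' : ℓ % 5 ≠ 0 := fun h ↦ h5 ((Nat.prime_dvd_prime_iff_eq Nat.prime_five hℓ).1 (Nat.dvd_of_mod_eq_zero h)).symm
  have key : ∀ n : ℕ, n % 2 = 1 → n % 5 ≠ 0 →
      (((n % 5 = 1 ∨ n % 5 = 4) ∧ ¬ (n % 8 = 1 ∨ n % 8 = 3)) ↔ (n % 40 = 21 ∨ n % 40 = 29 ∨ n % 40 = 31 ∨ n % 40 = 39)) := by
    intro n hn0 hn1
    obtain ⟨k', r, hr, rfl⟩ : ∃ k' r, r < 40 ∧ n = 40 * k' + r :=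
      ⟨n / 40, n % 40, Nat.mod_lt _ (by norm_num), (Nat.div_add_mod n 40).symm⟩
    interval_cases r <;> omega
  exact key ℓ hodd h5'

end IsqrtNeg2Sqrt5


/-! ### §44 `E = ℚ(√-2,√-5)` (`R = S² + 14S + 9`, `F = ℚ(√10)`, `E = F(√-2)`, `p² - 4q = 160 = 10·4²`):
  `[ℓ] ≠ [1] ⟺ ℓ ≡ 13, 31, 37, 39 (mod 40)` -/
section IsqrtNeg2SqrtNeg5
omit [Fact (Irreducible (cmPolyQ R))] in
/-- `√10 = (2θ + 14)/4` is an algebraic integer of `F` with square `10`. [folklore] -/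
theorem sqrtNeg2SqrtNeg5_ratPrimeRule_exists_sq_eq_10 (hR : R = X ^ 2 + C 14 * X + C 9) :
    ∃ s : 𝓞 (realField R), (s : realField R) = (2 * AdjoinRoot.root (realPolyQ R) + 14) / 4 ∧ s ^ 2 = 10 := by
  have hrel := root_rel_quadratic hR
  push_cast at hrel
  have hsq : ((2 * AdjoinRoot.root (realPolyQ R) + 14) / 4) ^ 2 = (10 : realField R) := by
    field_simp
    linear_combination (4 : realField R) * hrel
  have hint : IsIntegral ℤ ((2 * AdjoinRoot.root (realPolyQ R) + 14) / 4 : realField R) := by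
    refine ⟨X ^ 2 - C 10, by monicity!, ?_⟩
    simp [hsq]
  refine ⟨⟨_, hint⟩, rfl, ?_⟩
  refine RingOfIntegers.ext ?_
  simp only [map_pow, map_ofNat]
  exact hsq

omit [Fact (Irreducible (cmPolyQ R))] in
/-- **`F = ℚ(√10)` has exactly one dyadic place** (in this carrier's terms). [folklore] -/
theorem sqrtNeg2SqrtNeg5_ratPrimeRule_dyadic_unique (hR : R = X ^ 2 + C 14 * X + C 9) (v v' : HeightOneSpectrum (𝓞 (realField R)))
    (h2 : (2 : 𝓞 (realField R)) ∈ v.asIdeal) (h2' : (2 : 𝓞 (realField R)) ∈ v'.asIdeal) : v = v' := by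
  obtain ⟨s, -, hs⟩ := sqrtNeg2SqrtNeg5_ratPrimeRule_exists_sq_eq_10 hR
  exact place_unique_of_sq_eq_mul (finrank_realField_quadratic hR) Nat.prime_two (π := s) (w := 5) (a := -2)
    (b := 1) (by rw [hs]; norm_num) (by norm_num) v v' (by exact_mod_cast h2) (by exact_mod_cast h2')

/-- **`[2] = [1]`** for `ℚ(√-2,√-5)`: `2 = x² - (-2)·y²` with `x = 0`, `y = 1` in `F` (a norm from `E`).
[cite: Deligne1982HodgeCycles, §4 Cor. 4.2] -/
theorem sqrtNeg2SqrtNeg5_ratPrimeRule_mk_two_eq_splitDiscriminantClassCM (hR : R = X ^ 2 + C 14 * X + C 9) (qℓ : (realField R)ˣ) (hq : (qℓ : realField R) = 2)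
    {k : ℕ} (hk : Even k) : (QuotientGroup.mk qℓ : cmNormResidueGroup R) = splitDiscriminantClassCM R k := by
  have hrel := root_rel_quadratic hR
  push_cast at hrel
  have hfac : AdjoinRoot.root (realPolyQ R) = ((-3/4 : realField R) + (-1/4 : realField R) * AdjoinRoot.root (realPolyQ R)) ^ 2 * (-2 : realField R) := by
    linear_combination (1/8 : realField R) * hrel
  exact mk_eq_splitDiscriminantClassCM_of_eq_sq_sub_mul_sq hfac qℓ (x := (0 : realField R)) (y := (1 : realField R))
    (by rw [hq]; linear_combination (0 : realField R) * hrel) hk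

/-- **`[5] = [1]`** for `ℚ(√-2,√-5)`: `5 = x² - (-2)·y²` with `x = 0`, `y = (θ + 7)/4` in `F` (a norm from `E`).
[cite: Deligne1982HodgeCycles, §4 Cor. 4.2] -/
theorem sqrtNeg2SqrtNeg5_ratPrimeRule_mk_five_eq_splitDiscriminantClassCM (hR : R = X ^ 2 + C 14 * X + C 9) (qℓ : (realField R)ˣ) (hq : (qℓ : realField R) = 5)
    {k : ℕ} (hk : Even k) : (QuotientGroup.mk qℓ : cmNormResidueGroup R) = splitDiscriminantClassCM R k := by
  have hrel := root_rel_quadratic hR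
  push_cast at hrel
  have hfac : AdjoinRoot.root (realPolyQ R) = ((-3/4 : realField R) + (-1/4 : realField R) * AdjoinRoot.root (realPolyQ R)) ^ 2 * (-2 : realField R) := by
    linear_combination (1/8 : realField R) * hrel
  exact mk_eq_splitDiscriminantClassCM_of_eq_sq_sub_mul_sq hfac qℓ (x := (0 : realField R)) (y := ((7/4 : realField R) + (1/4 : realField R) * AdjoinRoot.root (realPolyQ R)))
    (by rw [hq]; linear_combination (-1/8 : realField R) * hrel) hk

/-- **THE RATIONAL PRIME RULE for `ℚ(√-2,√-5)`**: for EVERY rational prime `ℓ`, the class `[ℓ]` of the census table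
`W_{2k}.E.δ` (`k` even) is non-split iff **`ℓ ≡ 13, 31, 37, 39 (mod 40)`** — i.e. iff `ℓ` splits in `F = ℚ(√10)` into two places
inert in `E = F(√-2)` (`(160|ℓ) = 1`, `(-2|ℓ) = -1`); the primes `ℓ ∣ 2·160·2` are norms.
[cite: Deligne1982HodgeCycles, §4 (1) and Cor. 4.2] [cite: Omeara1963, §63B Example 63:12 and §71D Thm. 71:18] -/
theorem sqrtNeg2SqrtNeg5_mk_prime_ne_splitDiscriminantClassCM_iff_mod (hR : R = X ^ 2 + C 14 * X + C 9) {ℓ : ℕ} (hℓ : ℓ.Prime)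
    (qℓ : (realField R)ˣ) (hq : (qℓ : realField R) = ℓ) {k : ℕ} (hk : Even k) :
    (QuotientGroup.mk qℓ : cmNormResidueGroup R) ≠ splitDiscriminantClassCM R k ↔
      ℓ % 40 = 13 ∨ ℓ % 40 = 31 ∨ ℓ % 40 = 37 ∨ ℓ % 40 = 39 := by
  by_cases h2 : ℓ = 2
  · subst h2
    exact iff_of_false (not_not.2 (sqrtNeg2SqrtNeg5_ratPrimeRule_mk_two_eq_splitDiscriminantClassCM hR qℓ (by rw [hq]; norm_num) hk))
      (by omega)
  by_cases h5 : ℓ = 5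
  · subst h5
    exact iff_of_false (not_not.2 (sqrtNeg2SqrtNeg5_ratPrimeRule_mk_five_eq_splitDiscriminantClassCM hR qℓ (by rw [hq]; norm_num) hk))
      (by omega)
  haveI := Fact.mk hℓ
  obtain ⟨hRm, -⟩ := monic_and_natDegree_of_quadratic R hR
  obtain ⟨θₒ, hθ⟩ := exists_ringOfIntegers_coe_eq_root hRm
  have hroots := roots_real_neg_of_quadratic hR (by norm_num) (by norm_num) (by norm_num)
  have hrel := root_rel_quadratic hR
  push_cast at hrel
  have hdisc : ¬ (ℓ : ℤ) ∣ (14 : ℤ) ^ 2 - 4 * 9 := fun h ↦ by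
    have h' : ℓ ∣ 2 ^ 5 * 3 ^ 0 * 5 ^ 1 := by norm_num at h ⊢; exact_mod_cast h
    rcases eq_of_prime_dvd_two_pow_mul hℓ h' with rfl | rfl | rfl <;> omega
  have hm0 : (4 : ZMod ℓ) ≠ 0 := by
    have h : ¬ ℓ ∣ 4 := fun h ↦ by
      rcases eq_of_prime_dvd_two_pow_mul hℓ (a := 2) (b := 0) (c := 0) (by norm_num; exact h) with rfl | rfl | rfl <;> omega
    have := (not_congr (ZMod.natCast_eq_zero_iff 4 ℓ)).2 h
    exact_mod_cast this
  have hfac : AdjoinRoot.root (realPolyQ R) = -2 * ((-3/4 : realField R) + (-1/4 : realField R) * AdjoinRoot.root (realPolyQ R)) ^ 2 := by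
    linear_combination (1/8 : realField R) * hrel
  rw [mk_natCast_ne_splitDiscriminantClassCM_iff_of_root_eq_neg_two_mul_sq hR hroots hθ hfac (sqrtNeg2SqrtNeg5_ratPrimeRule_dyadic_unique hR) hℓ h2
    hdisc qℓ hq hk]
  push_cast
  rw [show (160 : ZMod ℓ) = 10 * 4 ^ 2 by norm_num, isSquare_mul_sq_iff_of_ne_zero hm0, isSquare_ten_iff h2 h5, ZMod.exists_sq_eq_neg_two_iff h2]
  have hodd : ℓ % 2 = 1 := (Nat.Prime.mod_two_eq_one_iff_ne_two hℓ).2 h2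
  have h5' : ℓ % 5 ≠ 0 := fun h ↦ h5 ((Nat.prime_dvd_prime_iff_eq Nat.prime_five hℓ).1 (Nat.dvd_of_mod_eq_zero h)).symm
  have key : ∀ n : ℕ, n % 2 = 1 → n % 5 ≠ 0 →
      (((n % 40 = 1 ∨ n % 40 = 3 ∨ n % 40 = 9 ∨ n % 40 = 13 ∨ n % 40 = 27 ∨ n % 40 = 31 ∨ n % 40 = 37 ∨ n % 40 = 39) ∧ ¬ (n % 8 = 1 ∨ n % 8 = 3)) ↔ (n % 40 = 13 ∨ n % 40 = 31 ∨ n % 40 = 37 ∨ n % 40 = 39)) := by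
    intro n hn0 hn1
    obtain ⟨k', r, hr, rfl⟩ : ∃ k' r, r < 40 ∧ n = 40 * k' + r :=
      ⟨n / 40, n % 40, Nat.mod_lt _ (by norm_num), (Nat.div_add_mod n 40).symm⟩
    interval_cases r <;> omega
  exact key ℓ hodd h5'

end IsqrtNeg2SqrtNeg5


/-! ### §45 `E = ℚ(i,√15)` (`R = S² + 32S + 196`, `F = ℚ(√15)`, `E = F(√-1)`, `p² - 4q = 240 = 15·4²`):
  `[ℓ] ≠ [1] ⟺ ℓ ≡ 7, 11, 43, 59 (mod 60)` -/
section IsqrtNeg1Sqrt15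
omit [Fact (Irreducible (cmPolyQ R))] in
/-- `√15 = (2θ + 32)/4` is an algebraic integer of `F` with square `15`. [folklore] -/
theorem sqrtNeg1Sqrt15_ratPrimeRule_exists_sq_eq_15 (hR : R = X ^ 2 + C 32 * X + C 196) :
    ∃ s : 𝓞 (realField R), (s : realField R) = (2 * AdjoinRoot.root (realPolyQ R) + 32) / 4 ∧ s ^ 2 = 15 := by
  have hrel := root_rel_quadratic hR
  push_cast at hrel
  have hsq : ((2 * AdjoinRoot.root (realPolyQ R) + 32) / 4) ^ 2 = (15 : realField R) := by
    field_simp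
    linear_combination (4 : realField R) * hrel
  have hint : IsIntegral ℤ ((2 * AdjoinRoot.root (realPolyQ R) + 32) / 4 : realField R) := by
    refine ⟨X ^ 2 - C 15, by monicity!, ?_⟩
    simp [hsq]
  refine ⟨⟨_, hint⟩, rfl, ?_⟩
  refine RingOfIntegers.ext ?_
  simp only [map_pow, map_ofNat]
  exact hsq

omit [Fact (Irreducible (cmPolyQ R))] in
/-- **`F = ℚ(√15)` has exactly one dyadic place** (in this carrier's terms). [folklore] -/
theorem sqrtNeg1Sqrt15_ratPrimeRule_dyadic_unique (hR : R = X ^ 2 + C 32 * X + C 196) (v v' : HeightOneSpectrum (𝓞 (realField R)))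
    (h2 : (2 : 𝓞 (realField R)) ∈ v.asIdeal) (h2' : (2 : 𝓞 (realField R)) ∈ v'.asIdeal) : v = v' := by
  obtain ⟨s, -, hs⟩ := sqrtNeg1Sqrt15_ratPrimeRule_exists_sq_eq_15 hR
  exact place_unique_of_sq_eq_mul (finrank_realField_quadratic hR) Nat.prime_two (π := 1 + s) (w := 8 + s) (a := -24)
    (b := 8 - s) (by push_cast; linear_combination hs) (by push_cast; linear_combination (-1 : 𝓞 (realField R)) * hs) v v' (by exact_mod_cast h2) (by exact_mod_cast h2')

/-- **`[2] = [1]`** for `ℚ(i,√15)`: `2 = x² - (-1)·y²` with `x = 1`, `y = 1` in `F` (a norm from `E`).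
[cite: Deligne1982HodgeCycles, §4 Cor. 4.2] -/
theorem sqrtNeg1Sqrt15_ratPrimeRule_mk_two_eq_splitDiscriminantClassCM (hR : R = X ^ 2 + C 32 * X + C 196) (qℓ : (realField R)ˣ) (hq : (qℓ : realField R) = 2)
    {k : ℕ} (hk : Even k) : (QuotientGroup.mk qℓ : cmNormResidueGroup R) = splitDiscriminantClassCM R k := by
  have hrel := root_rel_quadratic hR
  push_cast at hrel
  have hfac : AdjoinRoot.root (realPolyQ R) = ((-7 : realField R) + (-1/2 : realField R) * AdjoinRoot.root (realPolyQ R)) ^ 2 * (-1 : realField R) := by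
    linear_combination (1/4 : realField R) * hrel
  exact mk_eq_splitDiscriminantClassCM_of_eq_sq_sub_mul_sq hfac qℓ (x := (1 : realField R)) (y := (1 : realField R))
    (by rw [hq]; linear_combination (0 : realField R) * hrel) hk

/-- **`[3] = [1]`** for `ℚ(i,√15)`: `3 = x² - (-1)·y²` with `x = (3 + (θ + 16)/2)/4`, `y = (-3 + (θ + 16)/2)/4` in `F` (a norm from `E`).
[cite: Deligne1982HodgeCycles, §4 Cor. 4.2] -/
theorem sqrtNeg1Sqrt15_ratPrimeRule_mk_three_eq_splitDiscriminantClassCM (hR : R = X ^ 2 + C 32 * X + C 196) (qℓ : (realField R)ˣ) (hq : (qℓ : realField R) = 3)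
    {k : ℕ} (hk : Even k) : (QuotientGroup.mk qℓ : cmNormResidueGroup R) = splitDiscriminantClassCM R k := by
  have hrel := root_rel_quadratic hR
  push_cast at hrel
  have hfac : AdjoinRoot.root (realPolyQ R) = ((-7 : realField R) + (-1/2 : realField R) * AdjoinRoot.root (realPolyQ R)) ^ 2 * (-1 : realField R) := by
    linear_combination (1/4 : realField R) * hrel
  exact mk_eq_splitDiscriminantClassCM_of_eq_sq_sub_mul_sq hfac qℓ (x := ((11/4 : realField R) + (1/8 : realField R) * AdjoinRoot.root (realPolyQ R))) (y := ((5/4 : realField R) + (1/8 : realField R) * AdjoinRoot.root (realPolyQ R)))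
    (by rw [hq]; linear_combination (-1/32 : realField R) * hrel) hk

/-- **`[5] = [1]`** for `ℚ(i,√15)`: `5 = x² - (-1)·y²` with `x = (5 + (θ + 16)/2)/4`, `y = (-5 + (θ + 16)/2)/4` in `F` (a norm from `E`).
[cite: Deligne1982HodgeCycles, §4 Cor. 4.2] -/
theorem sqrtNeg1Sqrt15_ratPrimeRule_mk_five_eq_splitDiscriminantClassCM (hR : R = X ^ 2 + C 32 * X + C 196) (qℓ : (realField R)ˣ) (hq : (qℓ : realField R) = 5)
    {k : ℕ} (hk : Even k) : (QuotientGroup.mk qℓ : cmNormResidueGroup R) = splitDiscriminantClassCM R k := by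
  have hrel := root_rel_quadratic hR
  push_cast at hrel
  have hfac : AdjoinRoot.root (realPolyQ R) = ((-7 : realField R) + (-1/2 : realField R) * AdjoinRoot.root (realPolyQ R)) ^ 2 * (-1 : realField R) := by
    linear_combination (1/4 : realField R) * hrel
  exact mk_eq_splitDiscriminantClassCM_of_eq_sq_sub_mul_sq hfac qℓ (x := ((13/4 : realField R) + (1/8 : realField R) * AdjoinRoot.root (realPolyQ R))) (y := ((3/4 : realField R) + (1/8 : realField R) * AdjoinRoot.root (realPolyQ R)))
    (by rw [hq]; linear_combination (-1/32 : realField R) * hrel) hk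

/-- **THE RATIONAL PRIME RULE for `ℚ(i,√15)`**: for EVERY rational prime `ℓ`, the class `[ℓ]` of the census table
`W_{2k}.E.δ` (`k` even) is non-split iff **`ℓ ≡ 7, 11, 43, 59 (mod 60)`** — i.e. iff `ℓ` splits in `F = ℚ(√15)` into two places
inert in `E = F(√-1)` (`(240|ℓ) = 1`, `(-1|ℓ) = -1`); the primes `ℓ ∣ 2·240·1` are norms.
[cite: Deligne1982HodgeCycles, §4 (1) and Cor. 4.2] [cite: Omeara1963, §63B Example 63:12 and §71D Thm. 71:18] -/
theorem sqrtNeg1Sqrt15_mk_prime_ne_splitDiscriminantClassCM_iff_mod (hR : R = X ^ 2 + C 32 * X + C 196) {ℓ : ℕ} (hℓ : ℓ.Prime)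
    (qℓ : (realField R)ˣ) (hq : (qℓ : realField R) = ℓ) {k : ℕ} (hk : Even k) :
    (QuotientGroup.mk qℓ : cmNormResidueGroup R) ≠ splitDiscriminantClassCM R k ↔
      ℓ % 60 = 7 ∨ ℓ % 60 = 11 ∨ ℓ % 60 = 43 ∨ ℓ % 60 = 59 := by
  by_cases h2 : ℓ = 2
  · subst h2
    exact iff_of_false (not_not.2 (sqrtNeg1Sqrt15_ratPrimeRule_mk_two_eq_splitDiscriminantClassCM hR qℓ (by rw [hq]; norm_num) hk))
      (by omega)
  by_cases h3 : ℓ = 3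
  · subst h3
    exact iff_of_false (not_not.2 (sqrtNeg1Sqrt15_ratPrimeRule_mk_three_eq_splitDiscriminantClassCM hR qℓ (by rw [hq]; norm_num) hk))
      (by omega)
  by_cases h5 : ℓ = 5
  · subst h5
    exact iff_of_false (not_not.2 (sqrtNeg1Sqrt15_ratPrimeRule_mk_five_eq_splitDiscriminantClassCM hR qℓ (by rw [hq]; norm_num) hk))
      (by omega)
  haveI := Fact.mk hℓ
  obtain ⟨hRm, -⟩ := monic_and_natDegree_of_quadratic R hR
  obtain ⟨θₒ, hθ⟩ := exists_ringOfIntegers_coe_eq_root hRm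
  have hroots := roots_real_neg_of_quadratic hR (by norm_num) (by norm_num) (by norm_num)
  have hrel := root_rel_quadratic hR
  push_cast at hrel
  have hdisc : ¬ (ℓ : ℤ) ∣ (32 : ℤ) ^ 2 - 4 * 196 := fun h ↦ by
    have h' : ℓ ∣ 2 ^ 4 * 3 ^ 1 * 5 ^ 1 := by norm_num at h ⊢; exact_mod_cast h
    rcases eq_of_prime_dvd_two_pow_mul hℓ h' with rfl | rfl | rfl <;> omega
  have hm0 : (4 : ZMod ℓ) ≠ 0 := by
    have h : ¬ ℓ ∣ 4 := fun h ↦ by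
      rcases eq_of_prime_dvd_two_pow_mul hℓ (a := 2) (b := 0) (c := 0) (by norm_num; exact h) with rfl | rfl | rfl <;> omega
    have := (not_congr (ZMod.natCast_eq_zero_iff 4 ℓ)).2 h
    exact_mod_cast this
  have hfac : AdjoinRoot.root (realPolyQ R) = -((-7 : realField R) + (-1/2 : realField R) * AdjoinRoot.root (realPolyQ R)) ^ 2 := by
    linear_combination (1/4 : realField R) * hrel
  rw [mk_natCast_ne_splitDiscriminantClassCM_iff_of_root_eq_neg_sq hR hroots hθ hfac (sqrtNeg1Sqrt15_ratPrimeRule_dyadic_unique hR) hℓ h2 hdisc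
    qℓ hq hk]
  push_cast
  rw [show (240 : ZMod ℓ) = 15 * 4 ^ 2 by norm_num, isSquare_mul_sq_iff_of_ne_zero hm0, isSquare_fifteen_iff h2 h3 h5, ZMod.exists_sq_eq_neg_one_iff]
  have hodd : ℓ % 2 = 1 := (Nat.Prime.mod_two_eq_one_iff_ne_two hℓ).2 h2
  have h3' : ℓ % 3 ≠ 0 := fun h ↦ h3 ((Nat.prime_dvd_prime_iff_eq Nat.prime_three hℓ).1 (Nat.dvd_of_mod_eq_zero h)).symm
  have h5' : ℓ % 5 ≠ 0 := fun h ↦ h5 ((Nat.prime_dvd_prime_iff_eq Nat.prime_five hℓ).1 (Nat.dvd_of_mod_eq_zero h)).symm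
  have key : ∀ n : ℕ, n % 2 = 1 → n % 3 ≠ 0 → n % 5 ≠ 0 →
      (((n % 60 = 1 ∨ n % 60 = 7 ∨ n % 60 = 11 ∨ n % 60 = 17 ∨ n % 60 = 43 ∨ n % 60 = 49 ∨ n % 60 = 53 ∨ n % 60 = 59) ∧ ¬ (n % 4 ≠ 3)) ↔ (n % 60 = 7 ∨ n % 60 = 11 ∨ n % 60 = 43 ∨ n % 60 = 59)) := by
    intro n hn0 hn1 hn2
    obtain ⟨k', r, hr, rfl⟩ : ∃ k' r, r < 60 ∧ n = 60 * k' + r :=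
      ⟨n / 60, n % 60, Nat.mod_lt _ (by norm_num), (Nat.div_add_mod n 60).symm⟩
    interval_cases r <;> omega
  exact key ℓ hodd h3' h5'

end IsqrtNeg1Sqrt15


end Summit.HodgeConjecture.HodgeConjecture.Ring2.WeilCoverageCM

end
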